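import Summits.QuantumAdvantage.QuantumAdvantage.Statement
import Summits.QuantumAdvantage.QuantumAdvantage.Theorems.SoloBlindCeiling
import Literature.Computability.QuantumComplexity.OracleSeparationsProofs
import Literature.Computability.QuantumComplexity.OracleSeparationBQPBPPAlgebraic
import HarnessLib

/-!
# `QuantumAdvantage` is independent of relativising and of algebrising techniques — both directions

`SoloBlindCeiling.lean` recorded the two COLLAPSES proved in the Literature library: there are an
oracle `A` with `BQP^A ⊆ BPP^A` (`soloBlind_relativised_analogue_fails`) and an oracle `A` with a
multilinear extension `Ã` such that `BQP^Ã ⊆ BPP^A` (`soloBlind_algebrised_analogue_fails`); so no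
relativising or algebrising argument proves the summit. This file records the two SEPARATIONS the
library has meanwhile discharged, in the same summit form, and assembles the full independence
statements:

* `soloBlind_relativised_analogue_holds`: `∃ A, ∃ L, L ∈ BQP^A ∧ L ∉ BPP^A` — the summit holds
  relative to some oracle (Raz–Tal's Forrelation oracle diagonalised against `BPP^A` machines, tree
  theorem `exists_oracle_BQPRel_not_subset_BPPRel_holds`; printed: Bernstein–Vazirani 1997 Thm.
  8.4.2 via recursive Fourier sampling, Simon 1997 Thm. 3.3, Raz–Tal 2022 Cor. 1.5);
* `soloBlind_algebrised_analogue_holds`: `∃ A, ∃ L, L ∈ BQP^A ∧ L ∉ BPP^Ã` with `Ã` the multilinear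
  extension of `A` (Aaronson–Wigderson 2009, Thm. 5.11(v); tree theorem
  `exists_oracle_BQPRel_not_subset_BPPRel_multilinearExtension`, XOR-masked Forrelation);
* `soloBlind_relativisation_decides_nothing`, `soloBlind_algebrisation_decides_nothing`: the
  conjunctions with the Ceiling's collapses. Hence (meta-theoretically) neither `QuantumAdvantage`
  nor its negation `BQP ⊆ BPP` (`soloBlind_quantumAdvantage_iff_not_subset`) has a relativising or an
  algebrising proof: a DEQUANTISATION of `BQP` must be as non-black-box as a separation.

All inputs are discharged theorems of the tree (standard axioms); nothing here is progress towards
the summit or its negation — it is the certified symmetric barrier.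

References: E. Bernstein, U. Vazirani, SIAM J. Comput. 26 (1997) §8.4; D. Simon, SIAM J. Comput. 26
(1997) Thm. 3.3; R. Raz, A. Tal, J. ACM 69 (2022) Cor. 1.5, App. A; S. Aaronson, A. Wigderson,
ACM TOCT 1 (2009) Thm. 5.11; L. Fortnow, J. Rogers, JCSS 59 (1999) Thm. 4.2.
-/

namespace Summit.QuantumAdvantage.QuantumAdvantage.Theorems

open Literature.Computability.Complexity Literature.Computability.Complexity.Classes
  Literature.Computability.Cryptography Literature.Computability.QuantumComplexity

/-- The relativised analogue of the summit HOLDS somewhere: an oracle `A` and a language in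
`BQP^A ∖ BPP^A` (Raz–Tal Forrelation oracle; Bernstein–Vazirani 1997 Thm. 8.4.2). -/
theorem soloBlind_relativised_analogue_holds :
    ∃ A : Language Bool, ∃ L : Language Bool, L ∈ BQPRel A ∧ L ∉ BPPRel (Oracle.ofLanguage A) := by
  obtain ⟨A, hA⟩ := exists_oracle_BQPRel_not_subset_BPPRel_holds
  exact ⟨A, Set.not_subset.1 hA⟩

/-- The algebrised analogue of the summit HOLDS somewhere: an oracle `A` and a language in
`BQP^A ∖ BPP^Ã`, `Ã` the multilinear extension of `A` (Aaronson–Wigderson 2009, Thm. 5.11(v)). -/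
theorem soloBlind_algebrised_analogue_holds :
    ∃ A : Language Bool, ∃ L : Language Bool,
      L ∈ BQPRel A ∧ L ∉ BPPRel (multilinearExtension A).toOracle := by
  obtain ⟨A, hA⟩ := exists_oracle_BQPRel_not_subset_BPPRel_multilinearExtension
  exact ⟨A, Set.not_subset.1 hA⟩

/-- **Relativisation decides nothing about the summit**: its relativised analogue holds at one
oracle and fails at another (both kernel theorems over discharged facts). -/
theorem soloBlind_relativisation_decides_nothing :
    (∃ A : Language Bool, ∃ L : Language Bool, L ∈ BQPRel A ∧ L ∉ BPPRel (Oracle.ofLanguage A)) ∧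
    (∃ A : Language Bool, ¬ ∃ L : Language Bool, L ∈ BQPRel A ∧ L ∉ BPPRel (Oracle.ofLanguage A)) :=
  ⟨soloBlind_relativised_analogue_holds, soloBlind_relativised_analogue_fails⟩

/-- **Algebrisation decides nothing about the summit**: the algebrised analogue holds at one
oracle pair `(A, Ã)` (quantum side plain, classical side extended) and fails at another
(quantum side extended, classical side plain) — Aaronson–Wigderson 2009, Thm. 5.11(v) and Thm. 5.2. -/
theorem soloBlind_algebrisation_decides_nothing :
    (∃ A : Language Bool, ∃ L : Language Bool,
        L ∈ BQPRel A ∧ L ∉ BPPRel (multilinearExtension A).toOracle) ∧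
    (∃ (A : Language Bool) (Ã : ExtensionOracle), Ã.IsExtensionOf A 1 ∧
        ¬ ∃ L : Language Bool,
          L ∈ BQPRel (Oracle.bitLanguage Ã.toOracle) ∧ L ∉ BPPRel (Oracle.ofLanguage A)) :=
  ⟨soloBlind_algebrised_analogue_holds, soloBlind_algebrised_analogue_fails⟩

/-- The negation of the summit is the dequantisation statement `BQP ⊆ BPP`; by the two theorems
above it, too, has failing relativised and algebrised analogues. -/
theorem soloBlind_negation_iff_BQP_subset_BPP : ¬ _root_.QuantumAdvantage ↔ BQP ⊆ BPP := by
  rw [soloBlind_quantumAdvantage_iff_not_subset, not_not]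

end Summit.QuantumAdvantage.QuantumAdvantage.Theorems
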